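import Summits.Ventures.Crystal3D.Theorems.StickyWulffConstantGenericWallFloorRayTerraceDisc
import Summits.Ventures.Crystal3D.Theorems.StickyWulffConstantGenericWallFloorStackWalkRay
import HarnessLib

/-!
# The untilted terrace ray on the period disc, part 2: frames `ρᵏ·W_{k mod 4}` and the 4-periodic ray word
# (crux `GenericWallFloor`, stmt-Ventures-19480, line `WallLedgerG`; `rayWord_periodic_four` of cf-p1 (lxviii)/(lxx))

HONEST FRAMING. Venture `Summits/Ventures/Crystal3D` (cell `crystal3d-full`), helper `--supports` the crux
`GenericWallFloor` (stmt-Ventures-19480) of `route-Ventures-StickyWulffConstant`, REGISTERED line `WallLedgerG`, open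
stub `stub_twoSlabAdhesion`.  Rung credit only; F-C1 not moved; NOT the stub; census-free, standard axioms.

Continuation of `…RayTerraceDisc` (same setting: base frame `A`, `u = slotSite 8`, first push normal `n` = the terrace,
steering in the open period cone about the cubic axis `e = (0,1,2)`; `κ = cubicCoords ∘ A.symm`, `ρ = rotE (−2/3) (−1/3)`,
`discCS k` = parameters of `ρᵏ`).  There the directions and push normals were identified (`terraceDisc_levels`); here the
FRAMES and the MODEL WORD:

* `reflB` — the cubic reflection in the terrace numerator `b = (1,1,1)`; `discQ := reflB ∘ ρ⁻¹` — a ROTOREFLECTION OF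
  ORDER FOUR (`discQ_four`); `discW k := discQᵏ ∘ reflB` (`discW_add_four`: period `4`; `discW_zero … discW_three`: the four
  matrices `W_r`, entries in `(1/3)ℤ`).
* **`terraceDisc_frames`** — for every level `k` and every model vector `x`:
  `κ((forcedTop z ⟨A, u, 0⟩ n k).frame x) = rotE (discCS k) (discW k (cubicCoords x))`, i.e. the frame of level `k` is
  `A ∘ ρᵏ ∘ W_{k mod 4}` in cubic coordinates — 19480-p1's `T_{4m+r} = Pᵐ·W_r` (`P = ρ⁴`, `cos θ = −79/81`, irrational angle)
  with the finer one-step law; the set of all level frames lies in the compact family `{A ∘ R_φ ∘ W_r : φ ∈ S¹, r < 4}`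
  (`terraceDisc_frame_mem_family`), which is the (β′) parametrisation of the K-3 tail table (cf-p1 (lxviii)).
* `terraceDisc_dir` — the model direction slot of level `k` is `slotSite (terraceDirIdx k)`, the 4-cycle
  `(−1,−1,0), (0,1,−1), (1,−1,0), (0,1,1)` (= slots `3, 9, 1, 8`).
* `terraceLetter m` (cubic numerators `(1,1,1), (−1,−1,1), (−1,1,−1), (1,−1,−1)`, period `4`) and
  **`rayWord_terraceDisc`**: `rayWord z ⟨A, u, 0⟩ n m = [terraceLetter (m−1), …, terraceLetter 0]` for EVERY depth `m` —
  the tree's ray word is exactly 4-periodic (`terraceLetter_add_four`): in crossing order `a, −b, −c, −d, a, −b, …` with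
  `a = (1,1,1)`, `b = (1,1,−1)`, `c = (1,−1,1)`, `d = (−1,1,1)` (`/√3`), 19480-p1's «abcd» as mirror sequences.
WHAT THIS IS NOT: no statement about packings or cells; not the stub; F-C1 not moved; ray b of the same slot (through
`(−1,1,1)`, the mirror image, rotating by `ρ⁻¹`) and the lens are not treated here.
-/

noncomputable section

namespace Summit.Ventures.Crystal3D.Theorems

open Summit.Ventures.Crystal3D Finset Matrix
open scoped InnerProductSpace

/-! ### The rotoreflection `Q` and the four matrices `W_r` -/

/-- The cubic reflection in the terrace numerator `b = (1,1,1)` (`b·b = 3`): `w ↦ w − (2/3)(w·b) b`. -/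
def reflB (w : Fin 3 → ℝ) : Fin 3 → ℝ :=
  w - (2 / 3 * (w ⬝ᵥ (![1, 1, 1] : Fin 3 → ℝ))) • (![1, 1, 1] : Fin 3 → ℝ)

/-- `reflB` in coordinates. -/
theorem reflB_eq (w : Fin 3 → ℝ) :
    reflB w = ![(w 0 - 2 * w 1 - 2 * w 2) / 3, (-2 * w 0 + w 1 - 2 * w 2) / 3, (-2 * w 0 - 2 * w 1 + w 2) / 3] := by
  ext i; fin_cases i <;>
    simp [reflB, dotProduct, Fin.sum_univ_three, Matrix.cons_val_zero, Matrix.cons_val_one, Matrix.cons_val_two,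
      Matrix.head_cons, Matrix.tail_cons] <;> ring

/-- The ROTOREFLECTION `Q := reflB ∘ ρ⁻¹` (`ρ⁻¹ = rotE (−2/3) (1/3)`). -/
def discQ (w : Fin 3 → ℝ) : Fin 3 → ℝ :=
  reflB (rotE (-2 / 3) (1 / 3) w)

/-- `Q` in coordinates: the matrix `[[−4,−4,−7],[8,−1,−4],[−1,8,−4]]/9`. -/
theorem discQ_eq (w : Fin 3 → ℝ) :
    discQ w = ![(-4 * w 0 - 4 * w 1 - 7 * w 2) / 9, (8 * w 0 - w 1 - 4 * w 2) / 9, (-w 0 + 8 * w 1 - 4 * w 2) / 9] := by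
  rw [discQ, reflB_eq]
  ext i; fin_cases i <;> simp <;> ring

/-- **`Q` has order four.** -/
theorem discQ_four (w : Fin 3 → ℝ) : discQ (discQ (discQ (discQ w))) = w := by
  rw [discQ_eq, discQ_eq, discQ_eq, discQ_eq]
  ext i; fin_cases i <;> simp <;> ring

/-- The frame matrices `W_k := Qᵏ ∘ reflB` (so `W_{k+4} = W_k`). -/
def discW : ℕ → (Fin 3 → ℝ) → (Fin 3 → ℝ)
  | 0 => reflB
  | k + 1 => fun w => discQ (discW k w)

/-- Unfolding `discW 0`. -/
theorem discW_zero_apply (w : Fin 3 → ℝ) : discW 0 w = reflB w := rfl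

/-- Unfolding `discW (k + 1)`. -/
theorem discW_succ_apply (k : ℕ) (w : Fin 3 → ℝ) : discW (k + 1) w = discQ (discW k w) := rfl

/-- **Period four**: `W_{k+4} = W_k`. -/
theorem discW_add_four (k : ℕ) (w : Fin 3 → ℝ) : discW (k + 4) w = discW k w := by
  rw [show k + 4 = k + 1 + 1 + 1 + 1 from rfl, discW_succ_apply, discW_succ_apply, discW_succ_apply, discW_succ_apply,
    discQ_four]

/-- `W_0 = [[1,−2,−2],[−2,1,−2],[−2,−2,1]]/3`. -/
theorem discW_zero (w : Fin 3 → ℝ) :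
    discW 0 w = ![(w 0 - 2 * w 1 - 2 * w 2) / 3, (-2 * w 0 + w 1 - 2 * w 2) / 3, (-2 * w 0 - 2 * w 1 + w 2) / 3] := by
  rw [discW_zero_apply, reflB_eq]

/-- `W_1 = [[2,2,1],[2,−1,−2],[−1,2,−2]]/3`. -/
theorem discW_one (w : Fin 3 → ℝ) :
    discW 1 w = ![(2 * w 0 + 2 * w 1 + w 2) / 3, (2 * w 0 - w 1 - 2 * w 2) / 3, (-w 0 + 2 * w 1 - 2 * w 2) / 3] := by
  rw [discW_succ_apply, discW_zero, discQ_eq]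
  ext i; fin_cases i <;> simp <;> ring

/-- `W_2 = [[−1,−2,2],[2,1,2],[2,−2,−1]]/3`. -/
theorem discW_two (w : Fin 3 → ℝ) :
    discW 2 w = ![(-w 0 - 2 * w 1 + 2 * w 2) / 3, (2 * w 0 + w 1 + 2 * w 2) / 3, (2 * w 0 - 2 * w 1 - w 2) / 3] := by
  rw [discW_succ_apply, discW_one, discQ_eq]
  ext i; fin_cases i <;> simp <;> ring

/-- `W_3 = [[−2,2,−1],[−2,−1,2],[1,2,2]]/3` (`= ρ` itself). -/
theorem discW_three (w : Fin 3 → ℝ) :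
    discW 3 w = ![(-2 * w 0 + 2 * w 1 - w 2) / 3, (-2 * w 0 - w 1 + 2 * w 2) / 3, (w 0 + 2 * w 1 + 2 * w 2) / 3] := by
  rw [discW_succ_apply, discW_two, discQ_eq]
  ext i; fin_cases i <;> simp <;> ring

/-- `W_k` is homogeneous. -/
theorem discW_smul : ∀ (k : ℕ) (r : ℝ) (w : Fin 3 → ℝ), discW k (r • w) = r • discW k w
  | 0, r, w => by rw [discW_zero, discW_zero]; ext i; fin_cases i <;> simp <;> ring
  | k + 1, r, w => by
    rw [discW_succ_apply, discW_succ_apply, discW_smul k r w, discQ_eq, discQ_eq]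
    ext i; fin_cases i <;> simp <;> ring

/-- `ρᵏ = ρᵏ⁺¹ ∘ ρ⁻¹` at the parameter level: `rotE (discCS k) y = rotE (discCS (k+1)) (ρ⁻¹ y)`. -/
theorem rotE_discCS_prev (k : ℕ) (y : Fin 3 → ℝ) :
    rotE (discCS k).1 (discCS k).2 y = rotE (discCS (k + 1)).1 (discCS (k + 1)).2 (rotE (-2 / 3) (1 / 3) y) := by
  rw [rotE_rotE, discCS_succ]
  congr 1 <;> ring

/-- `rotE` intertwines `reflB ∘ ρ⁻¹` with the reflection in the CURRENT push normal: on the ellipse,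
`rotE c s y − (2/3)(rotE c s y · rotE c s b) rotE c s b = rotE c s (reflB y)`. -/
theorem rotE_reflB {c s : ℝ} (h : c ^ 2 + 5 * s ^ 2 = 1) (y : Fin 3 → ℝ) :
    rotE c s y - (2 / 3 * (rotE c s y ⬝ᵥ rotE c s ![1, 1, 1])) • rotE c s ![1, 1, 1] = rotE c s (reflB y) := by
  rw [rotE_dotProduct h, reflB, rotE_sub, rotE_smul]

/-! ### The frames -/

/-- **The frames of the disc ray.**  For every level `k` and every model vector `x`,
`κ((forcedTop z ⟨A, slotSite 8, 0⟩ n k).frame x) = rotE (discCS k) (W_k (cubicCoords x))`: level `k` carries the frame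
`A ∘ ρᵏ ∘ W_{k mod 4}` (cubic coordinates), `ρ = rotE (−2/3) (−1/3)`. -/
theorem terraceDisc_frames (A : EuclideanSpace ℝ (Fin 3) ≃ₗᵢ[ℝ] EuclideanSpace ℝ (Fin 3))
    {n z : EuclideanSpace ℝ (Fin 3)} {Zc : Fin 3 → ℝ} {t : ℝ} (hn : ‖n‖ = 1)
    (hmenu : ∀ w ∈ fccSlots, ⟪A w, n⟫_ℝ = 0 ∨ ⟪A w, n⟫_ℝ = Real.sqrt (2 / 3) ∨ ⟪A w, n⟫_ℝ = -Real.sqrt (2 / 3))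
    (hpos : ⟪A (slotSite 8), n⟫_ℝ = Real.sqrt (2 / 3))
    (hPn : cubicCoords (A.symm n) = (Real.sqrt 3)⁻¹ • (![(1 : ℝ), 1, 1] : Fin 3 → ℝ))
    (hZ : cubicCoords (A.symm z) = t • Zc) (ht : 0 < t)
    (hZe : 0 < Zc ⬝ᵥ (![0, 1, 2] : Fin 3 → ℝ)) (hZc : 9 * (Zc ⬝ᵥ Zc) < 2 * (Zc ⬝ᵥ (![0, 1, 2] : Fin 3 → ℝ)) ^ 2) :
    ∀ (k : ℕ) (x : EuclideanSpace ℝ (Fin 3)),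
      cubicCoords (A.symm ((forcedTop z ⟨A, slotSite 8, 0⟩ n k).frame x)) =
        rotE (discCS k).1 (discCS k).2 (discW k (cubicCoords x))
  | 0, x => by
    obtain ⟨-, hs3, -, -, -⟩ := sqrt_two_three_facts
    have hfr : (forcedTop z ⟨A, slotSite 8, 0⟩ n 0).frame = twinFrame A n := rfl
    rw [hfr, twinFrame_apply A hn, map_sub, cubicCoords_sub, LinearIsometryEquiv.map_smul, cubicCoords_smul,
      A.symm_apply_apply, inner_eq_cubic_symm A (A x) n, A.symm_apply_apply, hPn, dotProduct_smul, smul_smul,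
      discCS_zero, rotE_one_zero, discW_zero_apply, reflB]
    have h3inv : (Real.sqrt 3)⁻¹ * (Real.sqrt 3)⁻¹ = 1 / 3 := by rw [← mul_inv, hs3]; norm_num
    have e : 2 * ((Real.sqrt 3)⁻¹ • (cubicCoords x ⬝ᵥ ![1, 1, 1])) * (Real.sqrt 3)⁻¹ =
        2 / 3 * (cubicCoords x ⬝ᵥ ![1, 1, 1]) := by
      rw [smul_eq_mul, show (2 : ℝ) * ((Real.sqrt 3)⁻¹ * (cubicCoords x ⬝ᵥ ![1, 1, 1])) * (Real.sqrt 3)⁻¹ =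
        2 * (cubicCoords x ⬝ᵥ ![1, 1, 1]) * ((Real.sqrt 3)⁻¹ * (Real.sqrt 3)⁻¹) by ring, h3inv]
      ring
    rw [e]
  | k + 1, x => by
    have ih := terraceDisc_frames A hn hmenu hpos hPn hZ ht hZe hZc k
    obtain ⟨-, hs3, -, -, -⟩ := sqrt_two_three_facts
    obtain ⟨-, hP⟩ := terraceDisc_levels A hn hmenu hpos hPn hZ ht hZe hZc k
    have hN1 : ‖nextNormal (forcedTop z ⟨A, slotSite 8, 0⟩ n k)‖ = 1 :=
      (forcedTop_chain_invariant z A (slotSite 8) hn hmenu (k + 1)).1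
    have hfr : (forcedTop z ⟨A, slotSite 8, 0⟩ n (k + 1)).frame =
        twinFrame (forcedTop z ⟨A, slotSite 8, 0⟩ n k).frame (nextNormal (forcedTop z ⟨A, slotSite 8, 0⟩ n k)) := rfl
    rw [hfr, twinFrame_apply _ hN1, map_sub, cubicCoords_sub, LinearIsometryEquiv.map_smul, cubicCoords_smul,
      inner_eq_cubic_symm A, ih x, hP, dotProduct_smul, smul_smul, rotE_discCS_prev k]
    set y := rotE (-2 / 3) (1 / 3) (discW k (cubicCoords x)) with hy
    have h3inv : (Real.sqrt 3)⁻¹ * (Real.sqrt 3)⁻¹ = 1 / 3 := by rw [← mul_inv, hs3]; norm_num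
    set D := rotE (discCS (k + 1)).1 (discCS (k + 1)).2 y ⬝ᵥ rotE (discCS (k + 1)).1 (discCS (k + 1)).2 ![1, 1, 1] with hD
    have e : 2 * ((Real.sqrt 3)⁻¹ • D) * (Real.sqrt 3)⁻¹ = 2 / 3 * D := by
      rw [smul_eq_mul, show (2 : ℝ) * ((Real.sqrt 3)⁻¹ * D) * (Real.sqrt 3)⁻¹ =
        2 * D * ((Real.sqrt 3)⁻¹ * (Real.sqrt 3)⁻¹) by ring, h3inv]
      ring
    rw [e, hD, rotE_reflB (discCS_ellipse (k + 1)), discW_succ_apply, discQ, hy]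

/-- **The compact frame family.**  Every level frame is `A ∘ R ∘ W_r` with `R = rotE c s` a rotation about `(0,1,2)`
(`c² + 5s² = 1`) and `r < 4` — the `S¹ × 4` parametrisation of the K-3 tail table. -/
theorem terraceDisc_frame_mem_family (A : EuclideanSpace ℝ (Fin 3) ≃ₗᵢ[ℝ] EuclideanSpace ℝ (Fin 3))
    {n z : EuclideanSpace ℝ (Fin 3)} {Zc : Fin 3 → ℝ} {t : ℝ} (hn : ‖n‖ = 1)
    (hmenu : ∀ w ∈ fccSlots, ⟪A w, n⟫_ℝ = 0 ∨ ⟪A w, n⟫_ℝ = Real.sqrt (2 / 3) ∨ ⟪A w, n⟫_ℝ = -Real.sqrt (2 / 3))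
    (hpos : ⟪A (slotSite 8), n⟫_ℝ = Real.sqrt (2 / 3))
    (hPn : cubicCoords (A.symm n) = (Real.sqrt 3)⁻¹ • (![(1 : ℝ), 1, 1] : Fin 3 → ℝ))
    (hZ : cubicCoords (A.symm z) = t • Zc) (ht : 0 < t)
    (hZe : 0 < Zc ⬝ᵥ (![0, 1, 2] : Fin 3 → ℝ)) (hZc : 9 * (Zc ⬝ᵥ Zc) < 2 * (Zc ⬝ᵥ (![0, 1, 2] : Fin 3 → ℝ)) ^ 2)
    (k : ℕ) :
    ∃ c s : ℝ, c ^ 2 + 5 * s ^ 2 = 1 ∧ ∃ r < 4, ∀ x : EuclideanSpace ℝ (Fin 3),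
      cubicCoords (A.symm ((forcedTop z ⟨A, slotSite 8, 0⟩ n k).frame x)) = rotE c s (discW r (cubicCoords x)) := by
  refine ⟨(discCS k).1, (discCS k).2, discCS_ellipse k, k % 4, Nat.mod_lt k (by norm_num), fun x => ?_⟩
  rw [terraceDisc_frames A hn hmenu hpos hPn hZ ht hZe hZc k x]
  congr 1
  conv_lhs => rw [← Nat.div_add_mod k 4]
  generalize k / 4 = q
  induction q with
  | zero => rw [Nat.mul_zero, Nat.zero_add]
  | succ q ih => rw [show 4 * (q + 1) + k % 4 = 4 * q + k % 4 + 4 by ring, discW_add_four, ih]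


/-! ### Directions and letters -/

/-- Cubic numerators of the model direction slots of the disc ray, period `4`: `(−1,−1,0), (0,1,−1), (1,−1,0), (0,1,1)`. -/
def terraceDirNum : ℕ → (Fin 3 → ℝ)
  | 0 => ![-1, -1, 0]
  | 1 => ![0, 1, -1]
  | 2 => ![1, -1, 0]
  | 3 => ![0, 1, 1]
  | k + 4 => terraceDirNum k

/-- The slot indices of the direction cycle: `3, 9, 1, 8` (`slotInt`: `(−1,−1,0), (0,1,−1), (1,−1,0), (0,1,1)`). -/
def terraceDirIdx : ℕ → Fin 12
  | 0 => 3
  | 1 => 9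
  | 2 => 1
  | 3 => 8
  | k + 4 => terraceDirIdx k

/-- Period four of the direction numerators. -/
@[simp] theorem terraceDirNum_add_four (k : ℕ) : terraceDirNum (k + 4) = terraceDirNum k := rfl

/-- Period four of the direction indices. -/
@[simp] theorem terraceDirIdx_add_four (k : ℕ) : terraceDirIdx (k + 4) = terraceDirIdx k := rfl

/-- The direction slots in cubic coordinates: `cubicCoords (slotSite (terraceDirIdx k)) = (√2)⁻¹ • terraceDirNum k`. -/
theorem cubicCoords_slotSite_terraceDirIdx : ∀ k : ℕ,
    cubicCoords (slotSite (terraceDirIdx k)) = (Real.sqrt 2)⁻¹ • terraceDirNum k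
  | 0 => by
    rw [cubicCoords_slotSite]; ext i
    fin_cases i <;> simp [terraceDirIdx, terraceDirNum, NearIdentity.slotVec, NearIdentity.slotInt, div_eq_mul_inv]
  | 1 => by
    rw [cubicCoords_slotSite]; ext i
    fin_cases i <;> simp [terraceDirIdx, terraceDirNum, NearIdentity.slotVec, NearIdentity.slotInt, div_eq_mul_inv]
  | 2 => by
    rw [cubicCoords_slotSite]; ext i
    fin_cases i <;> simp [terraceDirIdx, terraceDirNum, NearIdentity.slotVec, NearIdentity.slotInt, div_eq_mul_inv]
  | 3 => by
    rw [cubicCoords_slotSite]; ext i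
    fin_cases i <;> simp [terraceDirIdx, terraceDirNum, NearIdentity.slotVec, NearIdentity.slotInt, div_eq_mul_inv]
  | k + 4 => by rw [terraceDirIdx_add_four, terraceDirNum_add_four]; exact cubicCoords_slotSite_terraceDirIdx k

/-- `W_k` maps the direction numerator of level `k` to `ρ (0,1,1) = (1/3, 1/3, 4/3)`. -/
theorem discW_terraceDirNum : ∀ k : ℕ, discW k (terraceDirNum k) = rotE (-2 / 3) (-1 / 3) ![0, 1, 1]
  | 0 => by rw [discW_zero]; ext i; fin_cases i <;> simp [terraceDirNum] <;> norm_num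
  | 1 => by rw [discW_one]; ext i; fin_cases i <;> simp [terraceDirNum] <;> norm_num
  | 2 => by rw [discW_two]; ext i; fin_cases i <;> simp [terraceDirNum] <;> norm_num
  | 3 => by rw [discW_three]; ext i; fin_cases i <;> simp [terraceDirNum] <;> norm_num
  | k + 4 => by rw [discW_add_four, terraceDirNum_add_four]; exact discW_terraceDirNum k

/-- Cubic numerators of the ray-word letters, period `4`: `(1,1,1), (−1,−1,1), (−1,1,−1), (1,−1,−1)` (`= a, −b, −c, −d`). -/
def terraceLetterNum : ℕ → (Fin 3 → ℝ)
  | 0 => ![1, 1, 1]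
  | 1 => ![-1, -1, 1]
  | 2 => ![-1, 1, -1]
  | 3 => ![1, -1, -1]
  | m + 4 => terraceLetterNum m

/-- Period four of the letter numerators. -/
@[simp] theorem terraceLetterNum_add_four (m : ℕ) : terraceLetterNum (m + 4) = terraceLetterNum m := rfl

/-- **The letters of the disc ray word**: the model unit `{111}` normal with cubic coordinates `(√3)⁻¹ • terraceLetterNum m`. -/
def terraceLetter (m : ℕ) : EuclideanSpace ℝ (Fin 3) :=
  (Real.sqrt 3)⁻¹ • (terraceLetterNum m 0 • cubicFrame 0 + terraceLetterNum m 1 • cubicFrame 1 +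
    terraceLetterNum m 2 • cubicFrame 2)

/-- **Period four of the letters**: `terraceLetter (m + 4) = terraceLetter m`. -/
@[simp] theorem terraceLetter_add_four (m : ℕ) : terraceLetter (m + 4) = terraceLetter m := by
  rw [terraceLetter, terraceLetter, terraceLetterNum_add_four]

/-- Cubic coordinates of the letters. -/
theorem cubicCoords_terraceLetter (m : ℕ) : cubicCoords (terraceLetter m) = (Real.sqrt 3)⁻¹ • terraceLetterNum m := by
  rw [terraceLetter, cubicCoords_smul, cubicCoords_add, cubicCoords_add, cubicCoords_smul, cubicCoords_smul,
    cubicCoords_smul, cubicCoords_cubicFrame, cubicCoords_cubicFrame, cubicCoords_cubicFrame]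
  congr 1
  ext i; fin_cases i <;> simp

/-- `W_k` maps the letter numerator `terraceLetterNum (k+1)` to `ρ (1,1,1) = (−1/3, −1/3, 5/3)`. -/
theorem discW_terraceLetterNum : ∀ k : ℕ, discW k (terraceLetterNum (k + 1)) = rotE (-2 / 3) (-1 / 3) ![1, 1, 1]
  | 0 => by rw [discW_zero]; ext i; fin_cases i <;> simp [terraceLetterNum] <;> norm_num
  | 1 => by rw [discW_one]; ext i; fin_cases i <;> simp [terraceLetterNum] <;> norm_num
  | 2 => by rw [discW_two]; ext i; fin_cases i <;> simp [terraceLetterNum] <;> norm_num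
  | 3 => by
    rw [discW_three, show (3 + 1 : ℕ) = 0 + 4 from rfl, terraceLetterNum_add_four]
    ext i; fin_cases i <;> simp [terraceLetterNum] <;> norm_num
  | k + 4 => by
    rw [discW_add_four, show k + 4 + 1 = k + 1 + 4 from rfl, terraceLetterNum_add_four]
    exact discW_terraceLetterNum k

section Ray

variable (A : EuclideanSpace ℝ (Fin 3) ≃ₗᵢ[ℝ] EuclideanSpace ℝ (Fin 3)) {n z : EuclideanSpace ℝ (Fin 3)}
  {Zc : Fin 3 → ℝ} {t : ℝ}

/-- **The direction slots of the disc ray**: level `k` moves along `slotSite (terraceDirIdx k)` (model slot; period `4`). -/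
theorem terraceDisc_dir (hn : ‖n‖ = 1)
    (hmenu : ∀ w ∈ fccSlots, ⟪A w, n⟫_ℝ = 0 ∨ ⟪A w, n⟫_ℝ = Real.sqrt (2 / 3) ∨ ⟪A w, n⟫_ℝ = -Real.sqrt (2 / 3))
    (hpos : ⟪A (slotSite 8), n⟫_ℝ = Real.sqrt (2 / 3))
    (hPn : cubicCoords (A.symm n) = (Real.sqrt 3)⁻¹ • (![(1 : ℝ), 1, 1] : Fin 3 → ℝ))
    (hZ : cubicCoords (A.symm z) = t • Zc) (ht : 0 < t)
    (hZe : 0 < Zc ⬝ᵥ (![0, 1, 2] : Fin 3 → ℝ)) (hZc : 9 * (Zc ⬝ᵥ Zc) < 2 * (Zc ⬝ᵥ (![0, 1, 2] : Fin 3 → ℝ)) ^ 2)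
    (k : ℕ) : (forcedTop z ⟨A, slotSite 8, 0⟩ n k).dir = slotSite (terraceDirIdx k) := by
  set e := forcedTop z ⟨A, slotSite 8, 0⟩ n k with he
  obtain ⟨hX, -⟩ := terraceDisc_levels A hn hmenu hpos hPn hZ ht hZe hZc k
  have hF := terraceDisc_frames A hn hmenu hpos hPn hZ ht hZe hZc k (slotSite (terraceDirIdx k))
  rw [← he] at hX hF
  rw [cubicCoords_slotSite_terraceDirIdx, discW_smul, rotE_smul, discW_terraceDirNum, ← rotE_discCS_succ, ← hX] at hF
  exact (e.frame.injective (A.symm.injective (cubicCoords_injective hF))).symm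

/-- **The letters of the disc ray**: the push normal of level `k` pulled back through the frame of level `k` is
`terraceLetter (k + 1)`. -/
theorem terraceDisc_letter (hn : ‖n‖ = 1)
    (hmenu : ∀ w ∈ fccSlots, ⟪A w, n⟫_ℝ = 0 ∨ ⟪A w, n⟫_ℝ = Real.sqrt (2 / 3) ∨ ⟪A w, n⟫_ℝ = -Real.sqrt (2 / 3))
    (hpos : ⟪A (slotSite 8), n⟫_ℝ = Real.sqrt (2 / 3))
    (hPn : cubicCoords (A.symm n) = (Real.sqrt 3)⁻¹ • (![(1 : ℝ), 1, 1] : Fin 3 → ℝ))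
    (hZ : cubicCoords (A.symm z) = t • Zc) (ht : 0 < t)
    (hZe : 0 < Zc ⬝ᵥ (![0, 1, 2] : Fin 3 → ℝ)) (hZc : 9 * (Zc ⬝ᵥ Zc) < 2 * (Zc ⬝ᵥ (![0, 1, 2] : Fin 3 → ℝ)) ^ 2)
    (k : ℕ) :
    (forcedTop z ⟨A, slotSite 8, 0⟩ n k).frame.symm (nextNormal (forcedTop z ⟨A, slotSite 8, 0⟩ n k)) =
      terraceLetter (k + 1) := by
  set e := forcedTop z ⟨A, slotSite 8, 0⟩ n k with he
  obtain ⟨-, hP⟩ := terraceDisc_levels A hn hmenu hpos hPn hZ ht hZe hZc k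
  have hF := terraceDisc_frames A hn hmenu hpos hPn hZ ht hZe hZc k (terraceLetter (k + 1))
  rw [← he] at hP hF
  rw [cubicCoords_terraceLetter, discW_smul, rotE_smul, discW_terraceLetterNum, ← rotE_discCS_succ, ← hP] at hF
  have hEq : e.frame (terraceLetter (k + 1)) = nextNormal e := A.symm.injective (cubicCoords_injective hF)
  rw [← hEq, LinearIsometryEquiv.symm_apply_apply]

/-- The first letter: `A.symm n = terraceLetter 0`. -/
theorem terraceDisc_letter_zero (hPn : cubicCoords (A.symm n) = (Real.sqrt 3)⁻¹ • (![(1 : ℝ), 1, 1] : Fin 3 → ℝ)) :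
    A.symm n = terraceLetter 0 := by
  apply cubicCoords_injective
  rw [hPn, cubicCoords_terraceLetter]
  rfl

/-- **The ray word of the disc ray, one level at a time**: `rayWord (m+1) = terraceLetter m :: rayWord m`. -/
theorem rayWord_terraceDisc_succ (hn : ‖n‖ = 1)
    (hmenu : ∀ w ∈ fccSlots, ⟪A w, n⟫_ℝ = 0 ∨ ⟪A w, n⟫_ℝ = Real.sqrt (2 / 3) ∨ ⟪A w, n⟫_ℝ = -Real.sqrt (2 / 3))
    (hpos : ⟪A (slotSite 8), n⟫_ℝ = Real.sqrt (2 / 3))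
    (hPn : cubicCoords (A.symm n) = (Real.sqrt 3)⁻¹ • (![(1 : ℝ), 1, 1] : Fin 3 → ℝ))
    (hZ : cubicCoords (A.symm z) = t • Zc) (ht : 0 < t)
    (hZe : 0 < Zc ⬝ᵥ (![0, 1, 2] : Fin 3 → ℝ)) (hZc : 9 * (Zc ⬝ᵥ Zc) < 2 * (Zc ⬝ᵥ (![0, 1, 2] : Fin 3 → ℝ)) ^ 2) :
    ∀ m : ℕ, rayWord z ⟨A, slotSite 8, 0⟩ n (m + 1) = terraceLetter m :: rayWord z ⟨A, slotSite 8, 0⟩ n m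
  | 0 => by
    rw [rayWord_one, rayWord_zero]
    exact congrArg (fun x => [x]) (terraceDisc_letter_zero A hPn)
  | j + 1 => by
    rw [rayWord_succ]
    have htop : rayTop z ⟨A, slotSite 8, 0⟩ n (j + 1) = forcedTop z ⟨A, slotSite 8, 0⟩ n j := rfl
    have hnrm : (forcedTop z ⟨A, slotSite 8, 0⟩ n (j + 1)).nrm = nextNormal (forcedTop z ⟨A, slotSite 8, 0⟩ n j) := rfl
    rw [htop, hnrm, terraceDisc_letter A hn hmenu hpos hPn hZ ht hZe hZc j]

/-- **`rayWord_periodic_four` (cf-p1 (lxviii)/(lxx)): the ray word of the untilted terrace ray on the period disc is the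
4-periodic word.**  For every depth `m`: `rayWord z ⟨A, slotSite 8, 0⟩ n m = [terraceLetter (m−1), …, terraceLetter 0]`
(most recent letter first), with `terraceLetter (j + 4) = terraceLetter j`. -/
theorem rayWord_terraceDisc (hn : ‖n‖ = 1)
    (hmenu : ∀ w ∈ fccSlots, ⟪A w, n⟫_ℝ = 0 ∨ ⟪A w, n⟫_ℝ = Real.sqrt (2 / 3) ∨ ⟪A w, n⟫_ℝ = -Real.sqrt (2 / 3))
    (hpos : ⟪A (slotSite 8), n⟫_ℝ = Real.sqrt (2 / 3))
    (hPn : cubicCoords (A.symm n) = (Real.sqrt 3)⁻¹ • (![(1 : ℝ), 1, 1] : Fin 3 → ℝ))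
    (hZ : cubicCoords (A.symm z) = t • Zc) (ht : 0 < t)
    (hZe : 0 < Zc ⬝ᵥ (![0, 1, 2] : Fin 3 → ℝ)) (hZc : 9 * (Zc ⬝ᵥ Zc) < 2 * (Zc ⬝ᵥ (![0, 1, 2] : Fin 3 → ℝ)) ^ 2) :
    ∀ m : ℕ, rayWord z ⟨A, slotSite 8, 0⟩ n m = ((List.range m).map terraceLetter).reverse
  | 0 => by rw [rayWord_zero, List.range_zero, List.map_nil, List.reverse_nil]
  | m + 1 => by
    rw [rayWord_terraceDisc_succ A hn hmenu hpos hPn hZ ht hZe hZc m, rayWord_terraceDisc hn hmenu hpos hPn hZ ht hZe hZc m,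
      List.range_succ, List.map_append, List.map_singleton, List.reverse_append, List.reverse_singleton,
      List.singleton_append]

end Ray

end Summit.Ventures.Crystal3D.Theorems

end
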